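import Mathlib
import HarnessLib
import Summits.Ventures.LatticeQCDFlow.Scaling.AutoregressiveGaugeHeatBathRanked
import Summits.Ventures.LatticeQCDFlow.Scaling.TorusTopLinkComb
import Summits.Ventures.LatticeQCDFlow.Scaling.TorusPlaquetteLastLinks
import Summits.Ventures.LatticeQCDFlow.Runbook.LatticeQCDFlowSanity

/-!
# LatticeQCDFlow / Scaling — the LAYERED ranked structure of `(ℤ/L)^d` in every dimension: all plaquettes
# containing the last direction, off the top layer, are ranked by height — `(d−1)(L−1)L^{d−1}` plaquettes
# carry an exact one-plaquette heat-bath autoregression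

HONEST FRAMING: exact (Metropolis-corrected) sampling algorithms for lattice gauge theory;
figures of merit are autocorrelation/cost numbers at stated couplings and volumes; no
continuum-physics claim.

Venture `LatticeQCDFlow` (cell pub-lqcd), topic `Scaling`, FANOUT row 30 (lean-1, GEN-24) — OUR WORK on
THEORY-2.md §4 row C5.  `Scaling/AutoregressiveGaugeHeatBathRanked` makes every RANKED plaquette collection
`B` (top-link assignment `t` injective on `B`, `rank p < rank p'` whenever `t p` lies on another `p' ∈ B`)
the carrier of an implementable EXACT heat-bath autoregressive sampler of `(F_B/Z_B)·Haar^{⊗E}`, and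
`Scaling/AutoregressiveGaugeHeatBathDimensionGap` shows such a `B` must leave `k ≥ #plaquettes/6` plaquettes
outside in `d ≥ 3` (`k ≥ 1` always, `k = 1` attained by the comb in `d = 2`).  THIS FILE gives the
explicit UPPER side in every dimension `d = n + 2 ≥ 2`: THE LAYERS.  `B` = the «vertical» plaquettes
`(x; i, d−1)` (`i < d−1`) whose base is off the top layer (`x_{d−1} ≠ −1`); `t p` = the third link
`(x + e_{d−1}, i)` (the copy of the bottom link one layer up); `rank p = x_{d−1}.val` (the height).

* §1 `layers_mem_links` (the third link), **`layers_injOn`**, **`layers_rank_lt`** — `B` is ranked: the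
  link `(x + e_{d−1}, i)` lies, among vertical plaquettes, only on `p` itself and on the plaquette
  `(x + e_{d−1}; i, d−1)` one layer UP (height `+1`, no wrap because `x_{d−1} ≠ −1`).
* §2 **`card_layers`** — `#B = (d−1)·((L−1)·L^{d−1})` (`Fintype.card_piFinset` on the sites, the `d − 1`
  planes containing the last direction); `card_plaquette_three` (bookkeeping:
  `#plaquettes = 3L³` in `d = 3`, with `Runbook/LatticeQCDFlowSanity.card_site`); **`card_compl_layers_three`** — in `d = 3` the layers
  leave exactly `k = L³ + 2L²` of the `3L³` plaquettes outside: between the sixth (`L³/2`, dimension gap)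
  and this third the least `k` of three dimensions lies.
* §3 **`integral_prod_weight_layers_eq_pow`** (`Z_B = c^{#B}`) and **`layers_arHybrid_eq_target`** — the
  heat-bath autoregressive model on the layers is EXACT for `F_B/Z_B` (`L ≥ 2`, `w` continuous with
  `0 < m ≤ w ≤ M`), in every dimension.

No `def`, no `sorry`, nothing cited as a fact beyond the tree.
-/

noncomputable section

namespace Summit.Ventures.LatticeQCDFlow.Theory2.Autoregressive

open MeasureTheory Function Finset
open Literature.MathematicalPhysics.QuantumFieldTheory Literature.MathematicalPhysics.QuantumLattice
open Summit.Ventures.LatticeQCDFlow.Exactness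

/-! ## §1 The layers are ranked -/

section Layers

variable {n L : ℕ} [NeZero L]

omit [NeZero L] in
/-- The layered assignment picks the third link `(x + e_j, i)` of `p = (x; i, j)`. [ours] -/
theorem layers_mem_links (p : Plaquette (n + 2) L) :
    ((p.1.shift p.2.1.2, p.2.1.1) : Edge (n + 2) L) ∈
      ({(p.1, p.2.1.1), (p.1.shift p.2.1.1, p.2.1.2), (p.1.shift p.2.1.2, p.2.1.1), (p.1, p.2.1.2)} :
        Finset (Edge (n + 2) L)) := by
  simp

/-- **The third-link assignment is injective on the vertical plaquettes** (second direction the last one).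
[ours] -/
theorem layers_injOn :
    Set.InjOn (fun p : Plaquette (n + 2) L => ((p.1.shift p.2.1.2, p.2.1.1) : Edge (n + 2) L))
      ↑((Finset.univ : Finset (Plaquette (n + 2) L)).filter
        (fun p => p.1 (Fin.last (n + 1)) ≠ -1 ∧ p.2.1.2 = Fin.last (n + 1))) := by
  intro p hp p' hp' h
  simp only [coe_filter, mem_univ, true_and, Set.mem_setOf_eq] at hp hp'
  obtain ⟨x, ⟨⟨i, j⟩, hij⟩⟩ := p
  obtain ⟨x', ⟨⟨i', j'⟩, hij'⟩⟩ := p'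
  simp only at hp hp' h hij hij'
  obtain ⟨-, rfl⟩ := hp
  obtain ⟨-, rfl⟩ := hp'
  have hi : i = i' := congrArg Prod.snd h
  have hx : x = x' := by
    have h1 : x.shift (Fin.last (n + 1)) = x'.shift (Fin.last (n + 1)) := congrArg Prod.fst h
    simpa [Site.shift] using h1
  subst hi; subst hx
  rfl

/-- **The layers are ranked by height**: for vertical plaquettes `p ≠ p'` off the top layer, if the third
link of `p` lies on `p'` then `p'` is the plaquette one layer up, of height `+1` (`L ≥ 2`). [ours] -/
theorem layers_rank_lt (hL : 2 ≤ L) :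
    ∀ p ∈ (Finset.univ : Finset (Plaquette (n + 2) L)).filter
        (fun p => p.1 (Fin.last (n + 1)) ≠ -1 ∧ p.2.1.2 = Fin.last (n + 1)),
      ∀ p' ∈ (Finset.univ : Finset (Plaquette (n + 2) L)).filter
        (fun p => p.1 (Fin.last (n + 1)) ≠ -1 ∧ p.2.1.2 = Fin.last (n + 1)), p ≠ p' →
      ((p.1.shift p.2.1.2, p.2.1.1) : Edge (n + 2) L) ∈
        ({(p'.1, p'.2.1.1), (p'.1.shift p'.2.1.1, p'.2.1.2), (p'.1.shift p'.2.1.2, p'.2.1.1),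
          (p'.1, p'.2.1.2)} : Finset (Edge (n + 2) L)) →
      (fun r : Plaquette (n + 2) L => (r.1 (Fin.last (n + 1))).val) p <
        (fun r : Plaquette (n + 2) L => (r.1 (Fin.last (n + 1))).val) p' := by
  intro p hp p' hp' hne hmem
  simp only [mem_filter, mem_univ, true_and] at hp hp'
  obtain ⟨x, ⟨⟨i, j⟩, hij⟩⟩ := p
  obtain ⟨x', ⟨⟨i', j'⟩, hij'⟩⟩ := p'
  simp only at hp hp' hij hij' hmem hne ⊢
  obtain ⟨hx, rfl⟩ := hp
  obtain ⟨-, rfl⟩ := hp'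
  simp only [Finset.mem_insert, Finset.mem_singleton] at hmem
  rcases hmem with h | h | h | h
  · -- `(x + e_last, i) = (x', i')`: the plaquette one layer up
    have hx' : x' = x.shift (Fin.last (n + 1)) := (congrArg Prod.fst h).symm
    rw [hx']
    simp only [Site.shift, Pi.add_apply, Pi.single_eq_same]
    rw [val_add_one_of_ne_neg_one hL hx]
    exact Nat.lt_succ_self _
  · have h2 : i = Fin.last (n + 1) := congrArg Prod.snd h
    exact absurd h2 (ne_of_lt hij)
  · have hi : i = i' := congrArg Prod.snd h
    have hxx : x = x' := by
      have h1 : x.shift (Fin.last (n + 1)) = x'.shift (Fin.last (n + 1)) := congrArg Prod.fst h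
      simpa [Site.shift] using h1
    subst hi; subst hxx
    exact absurd rfl hne
  · have h2 : i = Fin.last (n + 1) := congrArg Prod.snd h
    exact absurd h2 (ne_of_lt hij)

/-! ## §2 Counting the layers -/

omit [NeZero L] in
/-- The planes containing the last direction are the `n + 1` planes `(i, d−1)`, `i < d−1`. [ours] -/
theorem card_filter_plane_last :
    ((Finset.univ : Finset {q : Fin (n + 2) × Fin (n + 2) // q.1 < q.2}).filter
      (fun q => q.1.2 = Fin.last (n + 1))).card = n + 1 := by
  have h : (Finset.univ : Finset {q : Fin (n + 2) × Fin (n + 2) // q.1 < q.2}).filter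
      (fun q => q.1.2 = Fin.last (n + 1)) =
      (Finset.univ : Finset (Fin (n + 1))).map
        ⟨fun i => ⟨(i.castSucc, Fin.last (n + 1)), Fin.castSucc_lt_last i⟩,
          fun i i' hii' => Fin.castSucc_injective _ (congrArg (fun q => q.1.1) hii')⟩ := by
    ext q
    simp only [mem_filter, mem_univ, true_and, mem_map, Function.Embedding.coeFn_mk]
    constructor
    · intro hq
      obtain ⟨⟨a, b⟩, hab⟩ := q
      simp only at hq hab
      subst hq
      refine ⟨a.castPred (ne_of_lt hab), ?_⟩
      exact Subtype.ext (Prod.ext (Fin.castSucc_castPred _ _) rfl)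
    · rintro ⟨i, rfl⟩; rfl
  rw [h, card_map, card_univ, Fintype.card_fin]

/-- The sites off the top layer: `#{x : x_{d−1} ≠ −1} = (L−1)·L^{d−1}`. [ours] -/
theorem card_filter_site_last_ne :
    ((Finset.univ : Finset (Site (n + 2) L)).filter (fun x => x (Fin.last (n + 1)) ≠ -1)).card =
      (L - 1) * L ^ (n + 1) := by
  classical
  have h : (Finset.univ : Finset (Site (n + 2) L)).filter (fun x => x (Fin.last (n + 1)) ≠ -1) =
      Fintype.piFinset (fun i : Fin (n + 2) =>
        if i = Fin.last (n + 1) then (Finset.univ : Finset (ZMod L)).erase (-1) else Finset.univ) := by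
    ext x
    simp only [mem_filter, mem_univ, true_and, Fintype.mem_piFinset]
    constructor
    · intro hx i
      split_ifs with hi
      · subst hi; exact mem_erase.2 ⟨hx, mem_univ _⟩
      · exact mem_univ _
    · intro hx
      have := hx (Fin.last (n + 1))
      rw [if_pos rfl] at this
      exact (mem_erase.1 this).1
  rw [h, Fintype.card_piFinset, Fin.prod_univ_castSucc]
  simp only [Fin.castSucc_lt_last, ne_of_lt, if_false, card_univ, ZMod.card, prod_const,
    Fintype.card_fin, if_true]
  rw [card_erase_of_mem (mem_univ _), card_univ, ZMod.card, mul_comm]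

/-- **`#B = (d−1)·((L−1)·L^{d−1})`** for the layered collection of `(ℤ/L)^d`, `d = n + 2`. [ours] -/
theorem card_layers :
    ((Finset.univ : Finset (Plaquette (n + 2) L)).filter
        (fun p => p.1 (Fin.last (n + 1)) ≠ -1 ∧ p.2.1.2 = Fin.last (n + 1))).card =
      (L - 1) * L ^ (n + 1) * (n + 1) := by
  classical
  have h : (Finset.univ : Finset (Plaquette (n + 2) L)).filter
      (fun p => p.1 (Fin.last (n + 1)) ≠ -1 ∧ p.2.1.2 = Fin.last (n + 1)) =
      ((Finset.univ : Finset (Site (n + 2) L)).filter (fun x => x (Fin.last (n + 1)) ≠ -1)) ×ˢ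
        ((Finset.univ : Finset {q : Fin (n + 2) × Fin (n + 2) // q.1 < q.2}).filter
          (fun q => q.1.2 = Fin.last (n + 1))) := by
    ext p
    simp only [mem_filter, mem_univ, true_and, mem_product]
  rw [h, card_product, card_filter_site_last_ne, card_filter_plane_last]

/-- `#plaquettes = 3L³` in three dimensions (`Runbook.card_site`: `#sites = L^d`). [folklore] -/
theorem card_plaquette_three : Fintype.card (Plaquette 3 L) = 3 * L ^ 3 := by
  have h := two_mul_card_plaquette 3 L
  rw [Summit.Ventures.LatticeQCDFlow.Runbook.card_site] at h
  omega

/-- **In `d = 3` the layers leave exactly `k = L³ + 2L²` plaquettes outside** (of `3L³`; the dimension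
gap's floor is `L³/2`). [ours] -/
theorem card_compl_layers_three :
    (Finset.univ \ (Finset.univ : Finset (Plaquette 3 L)).filter
        (fun p => p.1 (Fin.last 2) ≠ -1 ∧ p.2.1.2 = Fin.last 2)).card = L ^ 3 + 2 * L ^ 2 := by
  rw [Finset.card_univ_sdiff, card_layers (n := 1), card_plaquette_three]
  have hL : 1 ≤ L := NeZero.one_le
  obtain ⟨L', rfl⟩ : ∃ L', L = L' + 1 := ⟨L - 1, (Nat.sub_add_cancel hL).symm⟩
  simp only [Nat.add_sub_cancel]
  ring_nf
  omega

end Layers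

/-! ## §3 The exact heat-bath sampler on the layers -/

section Sampler

variable {n L : ℕ} [NeZero L] {G : Type*} [Group G] [TopologicalSpace G] [IsTopologicalGroup G]
  [CompactSpace G] [SecondCountableTopology G] [MeasurableSpace G] [BorelSpace G]

/-- **`Z_B = c^{#B}` on the layers** (`L ≥ 2`, `w` continuous with `0 < m ≤ w ≤ M`), in every dimension
`d = n + 2`. [ours] -/
theorem integral_prod_weight_layers_eq_pow (hL : 2 ≤ L) {w : G → ℝ} (hw : Continuous w) {m M : ℝ}
    (hm0 : 0 < m) (hm : ∀ g, m ≤ w g) (hM : ∀ g, w g ≤ M) :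
    ∫ U, ∏ p ∈ (Finset.univ : Finset (Plaquette (n + 2) L)).filter
          (fun p => p.1 (Fin.last (n + 1)) ≠ -1 ∧ p.2.1.2 = Fin.last (n + 1)),
        w (plaquetteHolonomy U p.1 p.2.1.1 p.2.1.2) ∂(Measure.pi fun _ : Edge (n + 2) L => haarProbability G) =
      (∫ g, w g ∂(haarProbability G)) ^ ((L - 1) * L ^ (n + 1) * (n + 1)) := by
  rw [integral_prod_weight_eq_pow_of_rank hL hw hm0 hm hM _ _ (fun p _ => layers_mem_links p) _
    (layers_rank_lt hL), card_layers]

/-- **THE LAYERED SAMPLER IS EXACT** (every `d = n + 2`, `L ≥ 2`, `w` continuous with `0 < m ≤ w ≤ M`): with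
the conditioners `q_b(U) = ∏_{p ∈ B, (x_p + e_{d−1}, i_p) = b} w(U_p)/c` of the layered collection `B`, for
every duplicate-free list `l` of ALL links `(∏_{b∈l} q_b(U))·A_l F_B(U)/Z_B = F_B(U)/Z_B`; normalisation,
locality, causality and squeezing are `Scaling/AutoregressiveGaugeHeatBathRanked` / `…Comb` §0 with
`layers_injOn`, and a compatible order of all links is `PlaquetteTopLinkOrders.exists_order_of_topLink_rank`
with `layers_rank_lt`. [ours] -/
theorem layers_arHybrid_eq_target (hL : 2 ≤ L) {w : G → ℝ} (hw : Continuous w) {m M : ℝ}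
    (hm0 : 0 < m) (hm : ∀ g, m ≤ w g) (hM : ∀ g, w g ≤ M)
    (l : List (Edge (n + 2) L)) (hl : l.Nodup) (hall : ∀ e : Edge (n + 2) L, e ∈ l)
    (U : GaugeConfig (n + 2) L G) :
    (l.map fun b => ∏ p ∈ ((Finset.univ : Finset (Plaquette (n + 2) L)).filter
        (fun p => p.1 (Fin.last (n + 1)) ≠ -1 ∧ p.2.1.2 = Fin.last (n + 1))).filter
          (fun p' => ((p'.1.shift p'.2.1.2, p'.2.1.1) : Edge (n + 2) L) = b),
        w (plaquetteHolonomy U p.1 p.2.1.1 p.2.1.2) / (∫ g, w g ∂(haarProbability G))).prod *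
        coordAvg (haarProbability G) l.toFinset
          (fun V : GaugeConfig (n + 2) L G => ∏ p ∈ (Finset.univ : Finset (Plaquette (n + 2) L)).filter
            (fun p => p.1 (Fin.last (n + 1)) ≠ -1 ∧ p.2.1.2 = Fin.last (n + 1)),
              w (plaquetteHolonomy V p.1 p.2.1.1 p.2.1.2)) U /
        (∫ V, ∏ p ∈ (Finset.univ : Finset (Plaquette (n + 2) L)).filter
            (fun p => p.1 (Fin.last (n + 1)) ≠ -1 ∧ p.2.1.2 = Fin.last (n + 1)),
              w (plaquetteHolonomy V p.1 p.2.1.1 p.2.1.2)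
          ∂(Measure.pi fun _ : Edge (n + 2) L => haarProbability G)) =
      (∏ p ∈ (Finset.univ : Finset (Plaquette (n + 2) L)).filter
          (fun p => p.1 (Fin.last (n + 1)) ≠ -1 ∧ p.2.1.2 = Fin.last (n + 1)),
            w (plaquetteHolonomy U p.1 p.2.1.1 p.2.1.2)) /
        (∫ V, ∏ p ∈ (Finset.univ : Finset (Plaquette (n + 2) L)).filter
            (fun p => p.1 (Fin.last (n + 1)) ≠ -1 ∧ p.2.1.2 = Fin.last (n + 1)),
              w (plaquetteHolonomy V p.1 p.2.1.1 p.2.1.2)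
          ∂(Measure.pi fun _ : Edge (n + 2) L => haarProbability G)) :=
  ranked_arHybrid_eq_target hL hw hm0 hm hM _ _ (fun p _ => layers_mem_links p) _ (layers_rank_lt hL)
    l hl hall U

/-- **A compatible generation order for the layers** exists in every dimension: a duplicate-free list of
all links along which every layered plaquette is good. [ours] -/
theorem exists_layers_compatible_order (hL : 2 ≤ L) :
    ∃ l : List (Edge (n + 2) L), l.Nodup ∧ (∀ e : Edge (n + 2) L, e ∈ l) ∧
      ∀ p ∈ (Finset.univ : Finset (Plaquette (n + 2) L)).filter
          (fun p => p.1 (Fin.last (n + 1)) ≠ -1 ∧ p.2.1.2 = Fin.last (n + 1)),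
        ∀ e' ∈ ({(p.1, p.2.1.1), (p.1.shift p.2.1.1, p.2.1.2), (p.1.shift p.2.1.2, p.2.1.1),
            (p.1, p.2.1.2)} : Finset (Edge (n + 2) L)),
          e' ≠ ((p.1.shift p.2.1.2, p.2.1.1) : Edge (n + 2) L) →
            l.idxOf e' < l.idxOf ((p.1.shift p.2.1.2, p.2.1.1) : Edge (n + 2) L) :=
  exists_order_of_topLink_rank _ _ layers_injOn _ (layers_rank_lt hL)

end Sampler

end Summit.Ventures.LatticeQCDFlow.Theory2.Autoregressive

end
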